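import Mathlib
import Literature.RingTheory.Elimination.DistinctRootsSpecialization
import Literature.RingTheory.Elimination.IteratedResultantWalkLevels

/-!
# The iterated-resultant walk, II: lines in the zero set and the main lemma

Second half of the core algebraic lemma behind the hard case of the sweep
(`stub_sweepLine_hardCore` of crux stmt-Schanuel-0969, line kernel-arithmetic-selection); see
`Literature/RingTheory/Elimination/IteratedResultantWalkLevels.lean` for the setting and the level
polynomials `N_j(T; q)`.

* `eval_lineRestrict`, `natDegree_lineRestrict_le`, `card_le_sup_totalDegree_of_not_line_subset` —
  a line not contained in the common zero set `W` of finitely many polynomials meets `W` in at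
  most `max deg` points;
* `exists_line_subset` — **the walk produces a line**: at the base parameter `q₀` the product
  `∏_{j ≤ J} N_j(·; q₀)` has the `J = max deg + 1` distinct roots `c, 2c, …, Jc`; by lower
  semicontinuity of the number of distinct roots over the coordinate ring of the closure of `Λ₀`
  (`Literature.RingTheory.Elimination.card_roots_toFinset_le`) and density of `Λ₀`, the same holds
  at some `m ∈ Λ₀`, `m ≠ q₀`; all these roots are positions of points of `O ⊆ W` on the line
  `x + F(m - q₀)`, which therefore lies in `W`.

## References

* [Lang2002] S. Lang, *Algebra*, 3rd ed., GTM 211, Ch. IV §8 (the resultant; `Res(f, g) =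
  lc(f)^{deg g} ∏_{f(α)=0} g(α)` and its compatibility with ring homomorphisms).
-/

noncomputable section

open Polynomial

namespace Literature.RingTheory.Elimination.Walk

variable {F : Type*} [Field F] {n : ℕ}

/-! ### Lines: restriction of a polynomial to a line and the count of points on it -/

section Lines

/-- Restriction of `g ∈ F[X₁…Xₙ]` to the line `s ↦ x + s v` evaluates to `g(x + s v)`. [folklore] -/
theorem eval_lineRestrict (g : MvPolynomial (Fin n) F) (x v : Fin n → F) (s : F) :
    (MvPolynomial.aeval (fun i => C (x i) + C (v i) * X) g).eval s =
      MvPolynomial.eval (x + s • v) g := by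
  have h : ((Polynomial.aeval s : Polynomial F →ₐ[F] F)).comp
      (MvPolynomial.aeval fun i => C (x i) + C (v i) * X) = MvPolynomial.aeval (x + s • v) := by
    refine MvPolynomial.algHom_ext fun i => ?_
    simp only [AlgHom.coe_comp, Function.comp_apply, MvPolynomial.aeval_X, map_add, map_mul,
      Polynomial.aeval_C, Polynomial.aeval_X, Pi.add_apply, Pi.smul_apply, smul_eq_mul,
      Algebra.algebraMap_self, RingHom.id_apply]
    ring
  have := congrArg (fun φ : MvPolynomial (Fin n) F →ₐ[F] F => φ g) h
  simp only [AlgHom.coe_comp, Function.comp_apply] at this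
  rw [Polynomial.coe_aeval_eq_eval] at this
  exact this

/-- The restriction of `g` to a line has degree at most the total degree of `g`. [folklore] -/
theorem natDegree_lineRestrict_le (g : MvPolynomial (Fin n) F) (x v : Fin n → F) :
    (MvPolynomial.aeval (fun i => C (x i) + C (v i) * X) g).natDegree ≤ g.totalDegree := by
  classical
  conv_lhs => rw [MvPolynomial.as_sum g]
  rw [map_sum]
  refine Polynomial.natDegree_sum_le_of_forall_le _ _ fun d hd => ?_
  rw [MvPolynomial.aeval_monomial, ← Polynomial.C_eq_algebraMap]
  refine (natDegree_C_mul_le _ _).trans ?_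
  rw [Finsupp.prod]
  refine (natDegree_prod_le _ _).trans ?_
  have h1 : ∀ i, (C (x i) + C (v i) * X : Polynomial F).natDegree ≤ 1 := fun i =>
    (natDegree_add_le _ _).trans (max_le (by simp) ((natDegree_C_mul_le _ _).trans natDegree_X_le))
  have hi : ∀ i ∈ d.support, ((C (x i) + C (v i) * X : Polynomial F) ^ d i).natDegree ≤ d i := by
    intro i _
    refine natDegree_pow_le.trans ?_
    calc d i * (C (x i) + C (v i) * X : Polynomial F).natDegree ≤ d i * 1 :=
          Nat.mul_le_mul_left _ (h1 i)
      _ = d i := mul_one _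
  calc ∑ i ∈ d.support, ((C (x i) + C (v i) * X : Polynomial F) ^ d i).natDegree
        ≤ ∑ i ∈ d.support, d i := Finset.sum_le_sum hi
    _ = d.sum (fun _ e => e) := rfl
    _ ≤ g.totalDegree := MvPolynomial.le_totalDegree hd

/-- **A line not contained in the common zero set `W` of `G` meets `W` in at most
`max deg G` points.** [folklore] -/
theorem card_le_sup_totalDegree_of_not_line_subset [DecidableEq F]
    (G : Finset (MvPolynomial (Fin n) F)) (x v : Fin n → F)
    (hline : ¬ ∀ s : F, ∀ g ∈ G, MvPolynomial.eval (x + s • v) g = 0) (T : Finset F)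
    (hT : ∀ s ∈ T, ∀ g ∈ G, MvPolynomial.eval (x + s • v) g = 0) :
    T.card ≤ G.sup MvPolynomial.totalDegree := by
  -- some `g ∈ G` has nonzero restriction to the line
  obtain ⟨g, hg, hr⟩ : ∃ g ∈ G, MvPolynomial.aeval (fun i => C (x i) + C (v i) * X) g ≠ 0 := by
    by_contra h
    push Not at h
    exact hline fun s g hg => by rw [← eval_lineRestrict, h g hg, eval_zero]
  have hsub : T ⊆ (MvPolynomial.aeval (fun i => C (x i) + C (v i) * X) g).roots.toFinset := by
    intro s hs
    rw [Multiset.mem_toFinset, mem_roots hr, IsRoot.def, eval_lineRestrict]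
    exact hT s hs g hg
  calc T.card ≤ (MvPolynomial.aeval (fun i => C (x i) + C (v i) * X) g).roots.toFinset.card :=
        Finset.card_le_card hsub
    _ ≤ (MvPolynomial.aeval (fun i => C (x i) + C (v i) * X) g).roots.card :=
        Multiset.toFinset_card_le _
    _ ≤ (MvPolynomial.aeval (fun i => C (x i) + C (v i) * X) g).natDegree := card_roots' _
    _ ≤ g.totalDegree := natDegree_lineRestrict_le g x v
    _ ≤ G.sup MvPolynomial.totalDegree := Finset.le_sup hg

end Lines

/-! ### The main lemma -/

section Main

variable [IsAlgClosed F] [CharZero F] [DecidableEq F]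

/-- **The iterated-resultant walk produces a line.** See the module docstring. [folklore] -/
theorem exists_line_subset (G : Finset (MvPolynomial (Fin n) F)) {O : Set (Fin n → F)}
    (hOW : ∀ z ∈ O, ∀ g ∈ G, MvPolynomial.eval z g = 0)
    {M : Polynomial (MvPolynomial (Fin n) F)}
    (hO : ∀ z ∈ O, MvPolynomial.eval z M.leadingCoeff ≠ 0)
    {x : Fin n → F} (hx : x ∈ O) {c : F} (hc0 : c ≠ 0) (hc : (M.map (MvPolynomial.eval x)).IsRoot c)
    {Λ₀ : Set (Fin n → F)} {q₀ : Fin n → F} (hq₀ : q₀ ∈ Λ₀) (hΛ : ∃ m ∈ Λ₀, m ≠ q₀)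
    (hprime : (MvPolynomial.vanishingIdeal F Λ₀ : Ideal (MvPolynomial (Fin n) F)).IsPrime)
    (hwalk : ∀ m ∈ Λ₀, ∀ z ∈ O, ∀ θ : F, (M.map (MvPolynomial.eval z)).IsRoot θ →
      z + θ • (m - q₀) ∈ O) :
    ∃ m ∈ Λ₀, m ≠ q₀ ∧ ∀ s : F, ∀ g ∈ G, MvPolynomial.eval (x + s • (m - q₀)) g = 0 := by
  classical
  -- notation
  set 𝔭 : Ideal (MvPolynomial (Fin n) F) := MvPolynomial.vanishingIdeal F Λ₀ with h𝔭
  haveI := hprime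
  have hmem𝔭 : ∀ p : MvPolynomial (Fin n) F, p ∈ 𝔭 ↔ ∀ m ∈ Λ₀, MvPolynomial.eval m p = 0 := by
    intro p
    rw [h𝔭, MvPolynomial.mem_vanishingIdeal_iff]
    rfl
  -- `d ≥ 1`
  have hd : 1 ≤ M.natDegree := by
    by_contra h
    push Not at h
    have h0 : M.natDegree = 0 := by omega
    have hlc := hO x hx
    rw [Polynomial.leadingCoeff, h0] at hlc
    have hM : M.map (MvPolynomial.eval x) = C (MvPolynomial.eval x (M.coeff 0)) := by
      rw [Polynomial.eq_C_of_natDegree_eq_zero h0, Polynomial.map_C, coeff_C_zero]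
    have := hc
    rw [hM, IsRoot.def, eval_C] at this
    exact hlc this
  -- the product of the first `J` level polynomials
  set J : ℕ := G.sup MvPolynomial.totalDegree + 1 with hJ
  set N : Polynomial (MvPolynomial (Fin n) F) :=
    ∏ j ∈ Finset.range J, levelPoly M x q₀ j with hN
  have hspecN : ∀ m, spec m N = ∏ j ∈ Finset.range J, spec m (levelPoly M x q₀ j) := fun m => by
    rw [hN, map_prod]
  -- at parameters with the walk property: nonzero of degree `Ntot`, roots are positions in `O`
  set Ntot : ℕ := ∑ j ∈ Finset.range J, M.natDegree ^ (j + 1) with hNtot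
  have hgood : ∀ m, (∀ z ∈ O, ∀ θ : F, (M.map (MvPolynomial.eval z)).IsRoot θ →
      z + θ • (m - q₀) ∈ O) →
      spec m N ≠ 0 ∧ (spec m N).natDegree = Ntot ∧
        ∀ β ∈ (spec m N).roots, x + β • (m - q₀) ∈ O := by
    intro m hm
    have h := natDegree_spec_levelPoly hd hO hx hm
    have hne : ∀ j ∈ Finset.range J, spec m (levelPoly M x q₀ j) ≠ 0 := fun j _ => (h j).2.1
    refine ⟨?_, ?_, ?_⟩
    · rw [hspecN]; exact Finset.prod_ne_zero_iff.2 hne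
    · rw [hspecN, natDegree_prod _ _ hne, hNtot]
      exact Finset.sum_congr rfl fun j _ => (h j).1
    · intro β hβ
      rw [hspecN, roots_prod _ _ (Finset.prod_ne_zero_iff.2 hne), Multiset.mem_bind] at hβ
      obtain ⟨j, -, hj⟩ := hβ
      exact (h j).2.2 β hj
  have hwalk₀ : ∀ z ∈ O, ∀ θ : F, (M.map (MvPolynomial.eval z)).IsRoot θ →
      z + θ • (q₀ - q₀) ∈ O := fun z hz θ _ => by simpa using hz
  have hNtot1 : 1 ≤ Ntot := by
    rw [hNtot, hJ, Finset.sum_range_succ]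
    exact le_add_left (Nat.one_le_pow _ _ hd)
  -- pass to the coordinate ring `B = F[q] ⧸ 𝔭` of the closure of `Λ₀`
  set B := MvPolynomial (Fin n) F ⧸ 𝔭
  haveI : IsDomain B := Ideal.Quotient.isDomain 𝔭
  let φ : ∀ m ∈ Λ₀, B →+* F := fun m hm =>
    Ideal.Quotient.lift 𝔭 (MvPolynomial.eval m) fun p hp => (hmem𝔭 p).1 hp m hm
  have hφ : ∀ m (hm : m ∈ Λ₀), (φ m hm).comp (Ideal.Quotient.mk 𝔭) = MvPolynomial.eval m :=
    fun m hm => RingHom.ext fun _ => rfl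
  set Nbar : Polynomial B := N.map (Ideal.Quotient.mk 𝔭) with hNbar
  have hNbarφ : ∀ m (hm : m ∈ Λ₀), Nbar.map (φ m hm) = spec m N := fun m hm => by
    rw [hNbar, Polynomial.map_map, hφ m hm, Polynomial.coe_mapRingHom]
  -- `Nbar` has degree `Ntot`
  have hdegle : Nbar.natDegree ≤ Ntot := by
    by_contra hlt
    push Not at hlt
    -- the top coefficient of `Nbar` lies outside `𝔭`, hence is nonzero at some `m₁ ∈ Λ₀`
    have hlc : Nbar.leadingCoeff ≠ 0 := by
      intro h0
      rw [leadingCoeff_eq_zero] at h0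
      have := hNbarφ q₀ hq₀
      rw [h0, Polynomial.map_zero] at this
      exact (hgood q₀ hwalk₀).1 this.symm
    have hcoeff : Nbar.leadingCoeff = Ideal.Quotient.mk 𝔭 (N.coeff Nbar.natDegree) := by
      rw [Polynomial.leadingCoeff, hNbar, coeff_map]
    rw [hcoeff, Ne, Ideal.Quotient.eq_zero_iff_mem, hmem𝔭] at hlc
    push Not at hlc
    obtain ⟨m₁, hm₁, hne⟩ := hlc
    have h1 : (spec m₁ N).coeff Nbar.natDegree ≠ 0 := by
      rwa [Polynomial.coe_mapRingHom, coeff_map]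
    have h2 := le_natDegree_of_ne_zero h1
    rw [(hgood m₁ (hwalk m₁ hm₁)).2.1] at h2
    omega
  have hdeg : Nbar.natDegree = Ntot := by
    refine le_antisymm hdegle ?_
    rw [← (hgood q₀ hwalk₀).2.1, ← hNbarφ q₀ hq₀]
    exact natDegree_map_le
  have hlcφ : ∀ m (hm : m ∈ Λ₀), φ m hm Nbar.leadingCoeff ≠ 0 := by
    intro m hm
    have h := (natDegree_map_eq_iff (f := φ m hm) (p := Nbar)).1
      (by rw [hNbarφ m hm, (hgood m (hwalk m hm)).2.1, hdeg])
    rcases h with h | h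
    · exact h
    · exfalso; rw [hdeg] at h; omega
  -- lower semicontinuity of the number of distinct roots over `B`
  obtain ⟨Δbar, hΔ0, hΔ⟩ := Literature.RingTheory.Elimination.card_roots_toFinset_le F Nbar
  obtain ⟨Δ, rfl⟩ := Ideal.Quotient.mk_surjective Δbar
  have hΔ𝔭 : Δ ∉ 𝔭 := fun h => hΔ0 (Ideal.Quotient.eq_zero_iff_mem.2 h)
  -- a coordinate in which `Λ₀` moves away from `q₀`
  obtain ⟨m₁, hm₁, hm₁q⟩ := hΛ
  obtain ⟨i, hi⟩ : ∃ i, m₁ i ≠ q₀ i := by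
    by_contra h
    push Not at h
    exact hm₁q (funext h)
  have hℓ : (MvPolynomial.X i - MvPolynomial.C (q₀ i) : MvPolynomial (Fin n) F) ∉ 𝔭 := by
    intro h
    have := (hmem𝔭 _).1 h m₁ hm₁
    simp only [map_sub, MvPolynomial.eval_X, MvPolynomial.eval_C, sub_eq_zero] at this
    exact hi this
  have hprod : Δ * (MvPolynomial.X i - MvPolynomial.C (q₀ i)) ∉ 𝔭 := fun h =>
    (hprime.mem_or_mem h).elim hΔ𝔭 hℓ
  rw [hmem𝔭] at hprod
  push Not at hprod
  obtain ⟨m, hm, hm0⟩ := hprod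
  simp only [map_mul, map_sub, MvPolynomial.eval_X, MvPolynomial.eval_C, mul_ne_zero_iff,
    sub_ne_zero] at hm0
  refine ⟨m, hm, fun h => hm0.2 (by rw [h]), ?_⟩
  -- compare the number of distinct roots at `q₀` and at `m`
  have hcmp := hΔ (φ m hm) (φ q₀ hq₀) (hlcφ m hm) (hlcφ q₀ hq₀) (by
    change φ m hm (Ideal.Quotient.mk 𝔭 Δ) ≠ 0
    rw [← RingHom.comp_apply, hφ m hm]; exact hm0.1)
  rw [hNbarφ m hm, hNbarφ q₀ hq₀] at hcmp
  -- at `q₀`: at least `J` distinct roots `(j+1) c`, `j < J`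
  have hJle : J ≤ (spec q₀ N).roots.toFinset.card := by
    have hinj : Function.Injective fun j : ℕ => ((j + 1 : ℕ) : F) * c := by
      intro j j' h
      have h1 := mul_right_cancel₀ hc0 h
      have h2 : j + 1 = j' + 1 := by exact_mod_cast h1
      omega
    calc J = ((Finset.range J).image fun j : ℕ => ((j + 1 : ℕ) : F) * c).card := by
          rw [Finset.card_image_of_injective _ hinj, Finset.card_range]
      _ ≤ (spec q₀ N).roots.toFinset.card := by
          refine Finset.card_le_card fun β hβ => ?_
          rw [Finset.mem_image] at hβ
          obtain ⟨j, hj, rfl⟩ := hβ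
          rw [Multiset.mem_toFinset, hspecN,
            roots_prod _ _ (Finset.prod_ne_zero_iff.2 fun j _ =>
              (natDegree_spec_levelPoly hd hO hx hwalk₀ j).2.1), Multiset.mem_bind]
          exact ⟨j, hj, mul_mem_roots_spec_levelPoly hd hO hx hc j⟩
  -- at `m`: if the line were not in `W`, at most `J - 1` distinct roots
  by_contra hline
  have hT := card_le_sup_totalDegree_of_not_line_subset G x (m - q₀) hline
    (spec m N).roots.toFinset fun β hβ g hg =>
      hOW _ ((hgood m (hwalk m hm)).2.2 β (Multiset.mem_toFinset.1 hβ)) g hg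
  omega

end Main

end Literature.RingTheory.Elimination.Walk

end
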